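import Summits.QuantumFields.YangMills.Theorems.UnitScaleTiltProp7CovAgmonDecay
import Summits.QuantumFields.YangMills.Theorems.UnitScaleTiltProp7PinnedBiharmonicAgmonWindow
import HarnessLib

/-!
# Route `UnitScaleTilt`, crux K1 «MinimiserStabilityRegPr» (stmt-QuantumFields-19200), route-R E′ path (α′), (E1-b) covariant ∕ P-cov2 — (D2′-cov) THE NUMERIC WINDOW:
# `a√d·√A ≤ 1∕100` and `b·d·A ≤ 1∕50` discharge the two smallness rows `H1`, `H2` of ✓ `Prop7CovAgmonDecay.weighted_covLaplace_le_core` with ABSOLUTE constants —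
# `√Σω²hs(Δ_Ue) ≤ 3√Σω²hs(h) + 5√A·√Σω²hs(h̃) + 5A·√Σω²hs(s)`, `√Σω²hs(e) ≤ 3A·√Σω²hs(Δ_Ue)`, `√Σω²hs(D_Ue) ≤ 3√A·√Σω²hs(Δ_Ue)`

Cell `ym3-torus`, width seat `ym3-torus-px4` (gen 3); ★routeR-w3 g6 NAMER WORD (9b) 2026-08-28T21:58:57Z «px4 g3: F1-cov» (px11 g3 LOCATE-HK2COV #57 §4: F1-cov = (E-loc-cov) over
ym-routeR-w6 g6's F3b; px11's ASK 2(ii) «is the (D2′-cov) WINDOW wrapper in F3b or left to the consumer? F1-cov assumes consumer»).  This file IS that wrapper: the covariant twin of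
ym-routeR-w6 g5's ✓ `Prop7PinnedBiharmonicAgmonWindow.weighted_laplace_le_window` at `c = 1`, the arithmetic copied line by line (`√10 ≤ 16∕5`, `√3 ≤ 7∕4` reused by name).
THEOREMS ONLY (0 `def`, 0 `sorry`); `--supports stmt-QuantumFields-19200`, count-neutral.  YM₃ on T³ is a ladder rung (R3), not the Clay problem; nothing here claims a stub, the
crux, d = 4 or the mass gap.

WHAT IS PROVED (ns `…Theorems.Prop7CovAgmonWindow`).  ★★★ `weighted_covLaplace_le_window` — the data of ✓ `weighted_covLaplace_le_core` (unitary background `U` on the torus `T^{(i)}`,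
`N × N` matrix fields, scalar weight `ω > 0` with relative rows `a ≤ 1∕2`, `b`, the pinned covariant Poincaré row `hP` in root form with constant `A` — ✓ `…CovFramesRoot` ∕ ✓ `…CovMember`
at the member —, the pinned `e` with its Euler–Lagrange identity `hEL`), with `H1`, `H2` replaced by the window `a·√d·√A ≤ 1∕100`, `b·d·A ≤ 1∕50`; conclusion with absolute constants
`3, 5√A, 5A ∕ 3A ∕ 3√A` in the `ω`-weighted Hilbert–Schmidt letters of F3b.
HONEST SCOPE.  Arithmetic only (`t := a√d√A`: `p = √10·√A·t`, `pγ = (15√10∕4)t²`, `p² = 10At²`, `A′ ≤ 2.01A`, `γA′ ≤ 0.08√A`, `g₁ ≤ 2.01√A`, `τ ≤ 0.31`); (D1-cov), the weight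
rows and the EL identity stay displayed exactly as in F3b.

References: T. Bałaban, CMP 96 (1984) 223–250 [Balaban1984PropagatorsII] ((1.9) p.226); CMP 99 (1985) 389–434 [Balaban1985BackgroundPropagators] ((3.8) p.392).
-/

set_option autoImplicit false

noncomputable section

open scoped BigOperators Matrix.Norms.L2Operator Matrix

namespace Summit.QuantumFields.YangMills.Theorems.Prop7CovAgmonWindow

open Literature.MathematicalPhysics.QuantumFieldTheory.Balaban1983to89
open B9Eq39Adjoint (covD divB)
open B9TorusCalculus (torusT)
open Summit.QuantumFields.YangMills.Theorems.Prop7PinnedBiharmonicAgmonWindow (sqrt_ten_le)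
open Summit.QuantumFields.YangMills.Theorems.Prop7CovAgmonDecay (weighted_covLaplace_le_core)

variable {P : Params} {i : ℕ} {N : ℕ}
variable {U : Fin P.d → Site P i → (Matrix (Fin N) (Fin N) ℂ)ˣ}

set_option maxHeartbeats 400000 in
/-- ★★★ **(D2′-cov) AGMON, NUMERIC WINDOW.**  Same data as ✓ `weighted_covLaplace_le_core`, with the two smallness rows replaced by the window `a√d·√A ≤ 1∕100`, `b·d·A ≤ 1∕50`
(with `a = 2κ∕ℓ`, `b = 3κ∕ℓ²`, `A = √C_P·ℓ²`: `κ·(2√d·C_P^{1∕4}) ≤ 1∕100` and `κ·(3d√C_P) ≤ 1∕50`).  Conclusion with absolute constants: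
`√Σω²hs(Δ_Ue) ≤ 3√Σω²hs(h) + 5√A·√Σ_{x,μ}ω²hs(h̃_μ) + 5A·√Σω²hs(s)`, `√Σω²hs(e) ≤ 3A·√Σω²hs(Δ_Ue)`, `√Σ_{x,μ}ω²hs(D_μe) ≤ 3√A·√Σω²hs(Δ_Ue)`.
[cite: Balaban1984PropagatorsII, (1.9) p.226; Balaban1985BackgroundPropagators, (3.8) p.392] -/
theorem weighted_covLaplace_le_window (hU : ∀ ν x, (U ν x : Matrix (Fin N) (Fin N) ℂ) ∈ unitary (Matrix (Fin N) (Fin N) ℂ))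
    (C : Set (Site P i)) (ω : Site P i → ℝ) (e h s : Site P i → Matrix (Fin N) (Fin N) ℂ) (ht : Fin P.d → Site P i → Matrix (Fin N) (Fin N) ℂ)
    {a b A : ℝ} (ha0 : 0 ≤ a) (hb0 : 0 ≤ b) (hA : 0 ≤ A)
    (hω₀ : ∀ x, 0 < ω x)
    (hω₁ : ∀ x μ, |ω (x.shift μ) - ω x| ≤ a * ω x ∧ |ω (x.unshift μ) - ω x| ≤ a * ω x)
    (hω₂ : ∀ x μ, |ω (x.shift μ) + ω (x.unshift μ) - 2 * ω x| ≤ b * ω x)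
    (hP : ∀ v : Site P i → Matrix (Fin N) (Fin N) ℂ, (∀ y ∈ C, v y = 0) →
      Real.sqrt (∑ x, ∑ j : Fin N, ∑ k : Fin N, ‖(v x) j k‖ ^ 2)
        ≤ A * Real.sqrt (∑ x, ∑ j : Fin N, ∑ k : Fin N, ‖(divB (torusT P i) U (fun μ => covD (torusT P i) U μ v) x) j k‖ ^ 2))
    (he : ∀ y ∈ C, e y = 0)
    (hEL : ∀ v : Site P i → Matrix (Fin N) (Fin N) ℂ, (∀ y ∈ C, v y = 0) →
      ∑ x, (((divB (torusT P i) U (fun μ => covD (torusT P i) U μ e) x)ᴴ * divB (torusT P i) U (fun μ => covD (torusT P i) U μ v) x).trace).re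
        = ∑ x, (((h x)ᴴ * divB (torusT P i) U (fun μ => covD (torusT P i) U μ v) x).trace).re
          + ∑ x, ∑ μ, (((ht μ x)ᴴ * covD (torusT P i) U μ v x).trace).re
          + ∑ x, (((s x)ᴴ * v x).trace).re)
    (ha : a ≤ 1 / 2) (hwin₁ : a * Real.sqrt P.d * Real.sqrt A ≤ 1 / 100) (hwin₂ : b * P.d * A ≤ 1 / 50) :
    Real.sqrt (∑ x, ω x ^ 2 * ∑ j : Fin N, ∑ k : Fin N, ‖(divB (torusT P i) U (fun μ => covD (torusT P i) U μ e) x) j k‖ ^ 2)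
        ≤ 3 * Real.sqrt (∑ x, ω x ^ 2 * ∑ j : Fin N, ∑ k : Fin N, ‖(h x) j k‖ ^ 2)
          + 5 * Real.sqrt A * Real.sqrt (∑ x, ∑ μ, ω x ^ 2 * ∑ j : Fin N, ∑ k : Fin N, ‖(ht μ x) j k‖ ^ 2)
          + 5 * A * Real.sqrt (∑ x, ω x ^ 2 * ∑ j : Fin N, ∑ k : Fin N, ‖(s x) j k‖ ^ 2)
      ∧ Real.sqrt (∑ x, ω x ^ 2 * ∑ j : Fin N, ∑ k : Fin N, ‖(e x) j k‖ ^ 2)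
          ≤ 3 * A * Real.sqrt (∑ x, ω x ^ 2 * ∑ j : Fin N, ∑ k : Fin N, ‖(divB (torusT P i) U (fun μ => covD (torusT P i) U μ e) x) j k‖ ^ 2)
      ∧ Real.sqrt (∑ x, ∑ μ, ω x ^ 2 * ∑ j : Fin N, ∑ k : Fin N, ‖(covD (torusT P i) U μ e x) j k‖ ^ 2)
          ≤ 3 * Real.sqrt A * Real.sqrt (∑ x, ω x ^ 2 * ∑ j : Fin N, ∑ k : Fin N, ‖(divB (torusT P i) U (fun μ => covD (torusT P i) U μ e) x) j k‖ ^ 2) := by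
  have hd : (0 : ℝ) ≤ P.d := Nat.cast_nonneg _
  obtain ⟨hs10, hs3⟩ := sqrt_ten_le
  have hs10' : (3 : ℝ) ≤ Real.sqrt 10 := by rw [Real.le_sqrt (by norm_num) (by norm_num)]; norm_num
  have hs3' : 0 ≤ Real.sqrt 3 := Real.sqrt_nonneg _
  set sA := Real.sqrt A with hsA
  set sd := Real.sqrt (P.d : ℝ) with hsd
  have hsA0 : 0 ≤ sA := Real.sqrt_nonneg _
  have hsd0 : 0 ≤ sd := Real.sqrt_nonneg _
  have hsA2 : sA ^ 2 = A := Real.sq_sqrt hA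
  have hsd2 : sd ^ 2 = P.d := Real.sq_sqrt hd
  have hsqrt10d : Real.sqrt (10 * P.d) = Real.sqrt 10 * sd := Real.sqrt_mul (by norm_num) _
  -- the two window quantities
  set t := a * sd * sA with htdef
  have ht0 : 0 ≤ t := by positivity
  have ht1 : t ≤ 1 / 100 := hwin₁
  have ht2 : t ^ 2 = a ^ 2 * P.d * A := by rw [htdef]; simp only [mul_pow, hsA2, hsd2]
  set u := b * P.d * A with hudef
  have hu0 : 0 ≤ u := by positivity
  have hu1 : u ≤ 1 / 50 := hwin₂
  -- the derived constants of the core (at `c = 1`)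
  set p := Real.sqrt (10 * P.d) * A * a with hp
  set γ := 15 / 4 * a * Real.sqrt P.d with hγ
  set A' := 2 * A + 4 * p ^ 2 with hA'
  set g₁ := Real.sqrt (2 * A' + γ ^ 2 * A' ^ 2) with hg₁
  set τ := Real.sqrt (10 * P.d) * (5 / 2 * a) * g₁ + Real.sqrt 3 * P.d * (2 * a ^ 2 + 2 * b) * A' with hτ
  have hp' : p = Real.sqrt 10 * sA * t := by
    rw [hp, hsqrt10d, htdef]
    have : A = sA * sA := by rw [← sq, hsA2]
    rw [this]; ring
  have hpγ : p * γ = 15 / 4 * Real.sqrt 10 * t ^ 2 := by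
    rw [hp', hγ, ← hsd]
    have e1 : Real.sqrt 10 * sA * t * (15 / 4 * a * sd) = 15 / 4 * Real.sqrt 10 * t * (a * sd * sA) := by ring
    rw [e1, ← htdef]; ring
  have hp2 : p ^ 2 = 10 * A * t ^ 2 := by
    rw [hp', mul_pow, mul_pow, Real.sq_sqrt (by norm_num), hsA2]
  have ht2le : t ^ 2 ≤ 1 / 10000 := by nlinarith
  have hA'le : A' ≤ 201 / 100 * A := by
    have h1 : A * t ^ 2 ≤ A * (1 / 10000) := mul_le_mul_of_nonneg_left ht2le hA
    rw [hA', hp2]; linarith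
  have hA'0 : 0 ≤ A' := by rw [hA']; positivity
  have hγ0 : 0 ≤ γ := by rw [hγ]; positivity
  have hγA' : γ * A' ≤ 8 / 100 * sA := by
    have h1 : γ * A' ≤ γ * (201 / 100 * A) := mul_le_mul_of_nonneg_left hA'le hγ0
    have h2 : γ * (201 / 100 * A) = 201 / 100 * (15 / 4) * (t * sA) := by
      rw [hγ, ← hsd, htdef]
      have : A = sA * sA := by rw [← sq, hsA2]
      rw [this]; ring
    have h3 : t * sA ≤ 1 / 100 * sA := mul_le_mul_of_nonneg_right ht1 hsA0
    rw [h2] at h1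
    linarith
  have hγA'0 : 0 ≤ γ * A' := by positivity
  have hg₁le : g₁ ≤ 201 / 100 * sA := by
    rw [hg₁, Real.sqrt_le_left (by positivity)]
    have h1 : γ ^ 2 * A' ^ 2 = (γ * A') ^ 2 := by ring
    have h2 : (γ * A') ^ 2 ≤ (8 / 100 * sA) ^ 2 := pow_le_pow_left₀ hγA'0 hγA' 2
    have h3 : A' ≤ 201 / 100 * sA ^ 2 := by rw [hsA2]; exact hA'le
    have e1 : (8 / 100 * sA) ^ 2 = 64 / 10000 * sA ^ 2 := by ring
    have e2 : (201 / 100 * sA) ^ 2 = 40401 / 10000 * sA ^ 2 := by ring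
    rw [h1, e2]; rw [e1] at h2
    linarith
  have hg₁0 : 0 ≤ g₁ := Real.sqrt_nonneg _
  -- H1 and H2
  have H1 : p * γ + Real.sqrt 3 * P.d * b * A ≤ 1 / 4 := by
    rw [hpγ]
    have e1 : Real.sqrt 3 * P.d * b * A = Real.sqrt 3 * u := by rw [hudef]; ring
    rw [e1]
    have h1 : Real.sqrt 10 * t ^ 2 ≤ 16 / 5 * (1 / 10000) := mul_le_mul hs10 ht2le (sq_nonneg t) (by norm_num)
    have h2 : Real.sqrt 3 * u ≤ 7 / 4 * (1 / 50) := mul_le_mul hs3 hu1 hu0 (by norm_num)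
    linarith
  have H2 : τ ≤ 1 / 2 := by
    rw [hτ, hsqrt10d]
    have e1 : Real.sqrt 10 * sd * (5 / 2 * a) * g₁ = 5 / 2 * Real.sqrt 10 * (a * sd) * g₁ := by ring
    have e2 : Real.sqrt 3 * P.d * (2 * a ^ 2 + 2 * b) * A' = 2 * Real.sqrt 3 * ((a ^ 2 * P.d + b * P.d) * A') := by
      ring
    rw [e1, e2]
    have hacd : 0 ≤ a * sd := by positivity
    have h1 : (a * sd) * g₁ ≤ (a * sd) * (201 / 100 * sA) := mul_le_mul_of_nonneg_left hg₁le hacd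
    have h1' : (a * sd) * (201 / 100 * sA) = 201 / 100 * t := by rw [htdef]; ring
    have h2 : (a ^ 2 * P.d + b * P.d) * A' ≤ (a ^ 2 * P.d + b * P.d) * (201 / 100 * A) :=
      mul_le_mul_of_nonneg_left hA'le (by positivity)
    have h2' : (a ^ 2 * P.d + b * P.d) * (201 / 100 * A) = 201 / 100 * (t ^ 2 + u) := by rw [ht2, hudef]; ring
    have h3 : Real.sqrt 10 * ((a * sd) * g₁) ≤ 16 / 5 * (201 / 100 * t) :=
      mul_le_mul hs10 (h1.trans_eq h1') (by positivity) (by norm_num)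
    have h4 : Real.sqrt 3 * ((a ^ 2 * P.d + b * P.d) * A') ≤ 7 / 4 * (201 / 100 * (t ^ 2 + u)) :=
      mul_le_mul hs3 (h2.trans_eq h2') (by positivity) (by norm_num)
    have e3 : 5 / 2 * Real.sqrt 10 * (a * sd) * g₁ = 5 / 2 * (Real.sqrt 10 * ((a * sd) * g₁)) := by ring
    have e4 : 2 * Real.sqrt 3 * ((a ^ 2 * ↑P.d + b * ↑P.d) * A') = 2 * (Real.sqrt 3 * ((a ^ 2 * P.d + b * P.d) * A')) := by ring
    rw [e3, e4]
    linarith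
  -- apply the core estimate and weaken constants
  obtain ⟨hE, hN, hG⟩ := weighted_covLaplace_le_core hU C ω e h s ht ha0 ha hb0 hA hω₀ hω₁ hω₂ hP he hEL hp hγ hA' hg₁ hτ H1 H2
  have hHt0 : 0 ≤ Real.sqrt (∑ x, ∑ μ, ω x ^ 2 * ∑ j : Fin N, ∑ k : Fin N, ‖(ht μ x) j k‖ ^ 2) := Real.sqrt_nonneg _
  have hS0 : 0 ≤ Real.sqrt (∑ x, ω x ^ 2 * ∑ j : Fin N, ∑ k : Fin N, ‖(s x) j k‖ ^ 2) := Real.sqrt_nonneg _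
  have hE0 : 0 ≤ Real.sqrt (∑ x, ω x ^ 2 * ∑ j : Fin N, ∑ k : Fin N, ‖(divB (torusT P i) U (fun μ => covD (torusT P i) U μ e) x) j k‖ ^ 2) :=
    Real.sqrt_nonneg _
  refine ⟨hE.trans ?_, hN.trans ?_, hG.trans ?_⟩
  · have h1 : 2 * (g₁ + γ * A') ≤ 5 * sA := by linarith
    have h2 : 2 * A' ≤ 5 * A := by linarith
    have h3 := mul_le_mul_of_nonneg_right h1 hHt0
    have h4 := mul_le_mul_of_nonneg_right h2 hS0
    linarith
  · exact mul_le_mul_of_nonneg_right (by linarith) hE0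
  · exact mul_le_mul_of_nonneg_right (by linarith) hE0

end Summit.QuantumFields.YangMills.Theorems.Prop7CovAgmonWindow

end
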